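import Mathlib.Analysis.SpecialFunctions.Pow.Asymptotics
import Mathlib.Analysis.SpecialFunctions.Pow.Continuity
import Mathlib.Analysis.SpecialFunctions.Log.Basic
import HarnessLib

/-!
# The log-power scale at `0⁺`: divergent monomials `s ^ a * (log s) ^ b`

Topic `Literature/Analysis/Asymptotics` (theorems only). The monomials `s ^ a * (log s) ^ b`
(`a ∈ ℝ`, `b ∈ ℕ`) form an asymptotic scale as `s → 0⁺`, ordered lexicographically by
(least `a`, then largest `b`). The monomial is *divergent* at `0⁺` iff `a < 0`, or `a = 0` and
`0 < b`; the main statement of this file is the linear independence of the divergent monomials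
modulo functions with a finite limit at `0⁺`, in the form used to make constant terms of finite
log-power expansions well defined
(`Literature.NumberTheory.Transcendental.KZ.HasConstantTermAt.unique`):

* `eq_zero_of_tendsto_sum_divergentMonomials` — if a finite real combination
  `∑ i ∈ S, w i * s ^ (a i) * (log s) ^ (b i)` of divergent monomials has a finite limit `d` as
  `s → 0⁺`, then `d = 0`.

Proof: strong induction on the finite index set; multiply by the inverse of the dominant monomial
(which tends to `0`), so that the normalised sum tends both to `0` and to the total coefficient of
the dominant monomial; that coefficient vanishes, the dominant monomial is removed, and the
remaining sum is the same function. The comparison lemmas are Mathlib's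
(`tendsto_log_mul_rpow_nhdsGT_zero`, `Real.tendsto_log_nhdsGT_zero`,
`Real.continuousAt_rpow_const`). The same dominant-exponent argument, over the field of real
Puiseux series instead of germs at `0⁺`, is Kaiser 2017, Lemma 4.6 / Prop. 4.7.

## References

* T. Kaiser, *Lebesgue measure and integration theory on non-archimedean real closed fields with
  archimedean value group*, Proc. LMS 116 (2017), §4, Lemma 4.6, Prop. 4.7. [cite: Kaiser2017]
* G. Comte, J.-M. Lion, J.-P. Rolin, *Nature log-analytique du volume des sous-analytiques*,
  Illinois J. Math. 44 (2000) (where such expansions of parametric volumes come from).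
-/

noncomputable section

open Filter
open scoped Topology

namespace Literature.Analysis.Asymptotics

/-- `s ^ δ → 0` as `s → 0⁺`, for `δ > 0`. [folklore] -/
theorem tendsto_rpow_nhdsGT_zero_of_pos {δ : ℝ} (hδ : 0 < δ) :
    Tendsto (fun s : ℝ => s ^ δ) (𝓝[>] 0) (𝓝 0) := by
  have h := (Real.continuousAt_rpow_const 0 δ (Or.inr hδ.le)).tendsto
  rw [Real.zero_rpow hδ.ne'] at h
  exact h.mono_left nhdsWithin_le_nhds

/-- `(log s)⁻¹ → 0` as `s → 0⁺`. [folklore] -/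
theorem tendsto_inv_log_nhdsGT_zero : Tendsto (fun s : ℝ => (Real.log s)⁻¹) (𝓝[>] 0) (𝓝 0) :=
  Real.tendsto_log_nhdsGT_zero.inv_tendsto_atBot

/-- `s ^ δ * (log s) ^ b → 0` as `s → 0⁺`, for `δ > 0` and every `b : ℕ`
(from Mathlib's `tendsto_log_mul_rpow_nhdsGT_zero`). [folklore] -/
theorem tendsto_rpow_mul_log_pow_nhdsGT_zero {δ : ℝ} (hδ : 0 < δ) (b : ℕ) :
    Tendsto (fun s : ℝ => s ^ δ * Real.log s ^ b) (𝓝[>] 0) (𝓝 0) := by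
  rcases Nat.eq_zero_or_pos b with rfl | hb
  · simpa using tendsto_rpow_nhdsGT_zero_of_pos hδ
  have hb' : (b : ℝ) ≠ 0 := Nat.cast_ne_zero.mpr hb.ne'
  have h := (tendsto_log_mul_rpow_nhdsGT_zero (r := δ / b) (by positivity)).pow b
  rw [zero_pow hb.ne'] at h
  refine h.congr' ?_
  filter_upwards [self_mem_nhdsWithin] with s (hs : 0 < s)
  rw [mul_pow, mul_comm, ← Real.rpow_natCast (s ^ (δ / b)) b, ← Real.rpow_mul hs.le,
    div_mul_cancel₀ δ hb']

/-- The monomial `s ^ a * (log s) ^ b` with `a < 0`, or `a = 0 < b`, is *divergent* at `0⁺`: its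
inverse `s ^ (-a) * (log s)⁻¹ ^ b` tends to `0` (cf. Kaiser 2017, Lemma 4.6).
[cite: Kaiser2017, Lemma 4.6] -/
theorem tendsto_inv_divergentMonomial_nhdsGT_zero {a : ℝ} {b : ℕ} (hab : a < 0 ∨ (a = 0 ∧ 0 < b)) :
    Tendsto (fun s : ℝ => s ^ (-a) * (Real.log s)⁻¹ ^ b) (𝓝[>] 0) (𝓝 0) := by
  rcases hab with ha | ⟨rfl, hb⟩
  · have := (tendsto_rpow_nhdsGT_zero_of_pos (neg_pos.mpr ha)).mul
      (tendsto_inv_log_nhdsGT_zero.pow b)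
    rw [zero_mul] at this
    exact this
  · simpa [zero_pow hb.ne'] using tendsto_inv_log_nhdsGT_zero.pow b

/-- **Divergent log-power monomials form an asymptotic scale at `0⁺`.** If a finite real
combination `∑ i ∈ S, w i * s ^ (a i) * (log s) ^ (b i)` of monomials which are all *divergent*
at `0⁺` (`a i < 0`, or `a i = 0` and `0 < b i`) has a finite limit `d` as `s → 0⁺`, then `d = 0`.
Proof: strong induction on `S`; normalise by the dominant monomial (least `a`, then largest `b`),
whose total coefficient must therefore vanish, and remove it (cf. Kaiser 2017, Lemma 4.6 and
Prop. 4.7: the same dominant-exponent argument over the field of Puiseux series).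
[cite: Kaiser2017, Prop. 4.7] -/
theorem eq_zero_of_tendsto_sum_divergentMonomials {ι : Type*} {a : ι → ℝ} {b : ι → ℕ}
    {w : ι → ℝ} {d : ℝ} :
    ∀ S : Finset ι, (∀ i ∈ S, a i < 0 ∨ (a i = 0 ∧ 0 < b i)) →
      Tendsto (fun s : ℝ => ∑ i ∈ S, w i * s ^ (a i) * Real.log s ^ (b i)) (𝓝[>] 0) (𝓝 d) →
      d = 0 := by
  classical
  intro S
  induction S using Finset.strongInduction with
  | H S ih =>
    intro hab h
    rcases S.eq_empty_or_nonempty with rfl | hne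
    · simp only [Finset.sum_empty] at h
      exact tendsto_nhds_unique h tendsto_const_nhds
    -- the dominant (most divergent) exponent pair `(a₀, b₀)`: least `a`, then largest `b`
    obtain ⟨a₀, b₀, ⟨i₀, hi₀S, hai₀, hbi₀⟩, hdom⟩ :
        ∃ a₀ : ℝ, ∃ b₀ : ℕ, (∃ i ∈ S, a i = a₀ ∧ b i = b₀) ∧
          ∀ i ∈ S, a₀ < a i ∨ (a i = a₀ ∧ b i ≤ b₀) := by
      obtain ⟨i₁, hi₁, ha₁⟩ := S.exists_min_image a hne
      have hTne : (S.filter fun j => a j = a i₁).Nonempty :=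
        ⟨i₁, Finset.mem_filter.mpr ⟨hi₁, rfl⟩⟩
      obtain ⟨i₂, hi₂, hb₂⟩ := (S.filter fun j => a j = a i₁).exists_max_image b hTne
      obtain ⟨hi₂S, ha₂⟩ := Finset.mem_filter.mp hi₂
      refine ⟨a i₁, b i₂, ⟨i₂, hi₂S, ha₂, rfl⟩, fun i hi => ?_⟩
      rcases (ha₁ i hi).lt_or_eq with hlt | heq
      · exact Or.inl hlt
      · exact Or.inr ⟨heq.symm, hb₂ i (Finset.mem_filter.mpr ⟨hi, heq.symm⟩)⟩
    have hdiv₀ : a₀ < 0 ∨ (a₀ = 0 ∧ 0 < b₀) := by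
      rw [← hai₀, ← hbi₀]; exact hab i₀ hi₀S
    -- the indices carrying the dominant monomial
    set J := S.filter fun j => a j = a₀ ∧ b j = b₀ with hJ_def
    have hJS : J ⊆ S := Finset.filter_subset _ _
    have hJne : J.Nonempty := ⟨i₀, Finset.mem_filter.mpr ⟨hi₀S, hai₀, hbi₀⟩⟩
    -- the normalising factor `u = 1 / (s ^ a₀ * (log s) ^ b₀)` tends to `0`
    set u : ℝ → ℝ := fun s => s ^ (-a₀) * (Real.log s)⁻¹ ^ b₀ with hu_def
    have hu : Tendsto u (𝓝[>] 0) (𝓝 0) := tendsto_inv_divergentMonomial_nhdsGT_zero hdiv₀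
    -- eventually `0 < s < 1`, so that `log s ≠ 0`
    have hmem : ∀ᶠ s : ℝ in 𝓝[>] 0, 0 < s ∧ s < 1 := Ioo_mem_nhdsGT one_pos
    have hrew : ∀ i, ∀ s : ℝ, 0 < s → u s * (s ^ (a i) * Real.log s ^ (b i)) =
        s ^ (a i - a₀) * Real.log s ^ (b i) * (Real.log s)⁻¹ ^ b₀ := by
      intro i s hs
      simp only [hu_def]
      rw [sub_eq_neg_add, Real.rpow_add hs]
      ring
    -- limits of the normalised monomials: `1` on `J`, `0` off `J`
    set L : ι → ℝ := fun i => if a i = a₀ ∧ b i = b₀ then 1 else 0 with hL_def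
    have hlim : ∀ i ∈ S,
        Tendsto (fun s => u s * (s ^ (a i) * Real.log s ^ (b i))) (𝓝[>] 0) (𝓝 (L i)) := by
      intro i hi
      by_cases hJi : a i = a₀ ∧ b i = b₀
      · -- dominant index: the normalised monomial is eventually `1`
        obtain ⟨hai, hbi⟩ := hJi
        have hL : L i = 1 := by simp [hL_def, hai, hbi]
        rw [hL]
        have hev : ∀ᶠ s : ℝ in 𝓝[>] 0, u s * (s ^ (a i) * Real.log s ^ (b i)) = 1 := by
          filter_upwards [hmem] with s hs
          have hlog : Real.log s ≠ 0 := (Real.log_neg hs.1 hs.2).ne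
          rw [hrew i s hs.1, hai, hbi, sub_self, Real.rpow_zero, one_mul, ← mul_pow,
            mul_inv_cancel₀ hlog, one_pow]
        exact tendsto_const_nhds.congr' (hev.mono fun s hs => hs.symm)
      · have hL : L i = 0 := by simp [hL_def, hJi]
        rw [hL]
        rcases hdom i hi with hai | ⟨hai, hble⟩
        · -- strictly larger power of `s`
          have key := (tendsto_rpow_mul_log_pow_nhdsGT_zero (sub_pos.mpr hai) (b i)).mul
            (tendsto_inv_log_nhdsGT_zero.pow b₀)
          rw [zero_mul] at key
          refine key.congr' ?_
          filter_upwards [hmem] with s hs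
          rw [hrew i s hs.1]
        · -- same power of `s`, strictly smaller power of `log s`
          have hbi : b i < b₀ := lt_of_le_of_ne hble fun h => hJi ⟨hai, h⟩
          have key : Tendsto (fun s : ℝ => (Real.log s)⁻¹ ^ (b₀ - b i)) (𝓝[>] 0) (𝓝 0) := by
            simpa [zero_pow (Nat.sub_ne_zero_of_lt hbi)] using
              tendsto_inv_log_nhdsGT_zero.pow (b₀ - b i)
          refine key.congr' ?_
          filter_upwards [hmem] with s hs
          have hlog : Real.log s ≠ 0 := (Real.log_neg hs.1 hs.2).ne
          rw [eq_comm, hrew i s hs.1, hai, sub_self, Real.rpow_zero, one_mul,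
            ← pow_sub_mul_pow (Real.log s)⁻¹ hbi.le, mul_left_comm, ← mul_pow,
            mul_inv_cancel₀ hlog, one_pow, mul_one]
    -- hence `u * P → ∑ i ∈ S, w i * L i`, while also `u * P → 0 * d = 0`
    have hsum : Tendsto (fun s => u s * ∑ i ∈ S, w i * s ^ (a i) * Real.log s ^ (b i)) (𝓝[>] 0)
        (𝓝 (∑ i ∈ S, w i * L i)) := by
      have := tendsto_finsetSum S fun i hi => (hlim i hi).const_mul (w i)
      refine this.congr fun s => ?_
      rw [Finset.mul_sum]
      exact Finset.sum_congr rfl fun i _ => by ring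
    have hWJ : ∑ i ∈ J, w i = 0 := by
      have h0 : ∑ i ∈ S, w i * L i = 0 := by
        have := hu.mul h
        rw [zero_mul] at this
        exact tendsto_nhds_unique hsum this
      rw [hJ_def, Finset.sum_filter]
      simpa [hL_def, mul_ite] using h0
    -- remove the dominant monomial: the remaining sum is the same function
    have hsplit : ∀ s : ℝ, ∑ i ∈ S \ J, w i * s ^ (a i) * Real.log s ^ (b i) =
        ∑ i ∈ S, w i * s ^ (a i) * Real.log s ^ (b i) := by
      intro s
      rw [← Finset.sum_sdiff hJS, left_eq_add]
      calc ∑ i ∈ J, w i * s ^ (a i) * Real.log s ^ (b i)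
          = ∑ i ∈ J, w i * (s ^ a₀ * Real.log s ^ b₀) := by
            refine Finset.sum_congr rfl fun i hi => ?_
            obtain ⟨-, hai, hbi⟩ := Finset.mem_filter.mp hi
            rw [hai, hbi, mul_assoc]
        _ = 0 := by rw [← Finset.sum_mul, hWJ, zero_mul]
    exact ih (S \ J) (Finset.sdiff_ssubset hJS hJne) (fun i hi => hab i (Finset.sdiff_subset hi))
      (h.congr fun s => (hsplit s).symm)

/-- **Uniqueness of finite log-power expansions modulo `o(1)`** (Fintype-indexed form of
`eq_zero_of_tendsto_sum_divergentMonomials`): if `f` tends to `c` and `f - P` tends to `c'` at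
`0⁺`, where `P` is a finite combination of divergent monomials, then `c = c'`.
[cite: Kaiser2017, Prop. 4.7] -/
theorem tendsto_nhds_unique_of_sub_sum_divergentMonomials {ι : Type*} [Fintype ι] {a : ι → ℝ}
    {b : ι → ℕ} {w : ι → ℝ} {f : ℝ → ℝ} {c c' : ℝ} (hab : ∀ i, a i < 0 ∨ (a i = 0 ∧ 0 < b i))
    (hc : Tendsto f (𝓝[>] 0) (𝓝 c))
    (hc' : Tendsto (fun s : ℝ => f s - ∑ i, w i * s ^ (a i) * Real.log s ^ (b i)) (𝓝[>] 0)
      (𝓝 c')) :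
    c = c' := by
  have key : Tendsto (fun s : ℝ => ∑ i, w i * s ^ (a i) * Real.log s ^ (b i)) (𝓝[>] 0)
      (𝓝 (c - c')) :=
    (hc.sub hc').congr fun s => by ring
  have := eq_zero_of_tendsto_sum_divergentMonomials Finset.univ (fun i _ => hab i) key
  linarith

end Literature.Analysis.Asymptotics
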